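import Summits.NavierStokesRegularity.NavierStokesRegularity.Theses.AngularGalerkinLadder
import Summits.NavierStokesRegularity.NavierStokesRegularity.Theorems.RungBlowupCofinal.Negative.RungZeroNotSingular

/-!
# Route `AngularGalerkinLadder` · K3a `LocalCompactness` / K2 `NoOverheating` — Negative lane:
# there are no rung-0 window profiles with a positive amplitude floor

Cell `ns-blowup`, seat `ns-blowup-refuter5` (g2), K5-42 (4). `--supports stmt-NavierStokesRegularity-19856`.
LABEL: KERNEL, Negative lane (small-model fact; asserts no Theses statement positively).

By `rung_zero_slice_eq_zero` (p484389) every slice of a rung-0 solution vanishes, so a window profile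
`IsWindowProfile 0 C₀ cmin cmax δ ε c R u p d` forces `δ ≤ 0`: the window classes quantified by
`LocalCompactness` / `NoOverheating` / `LimitTransfer` (which carry `0 < δ`) contain no rung-0 member,
i.e. every window sequence lives on rungs `L n ≥ 1`. This is the formal content of «stub A of the K3a
engine line is vacuous at L = 0» (refuter5 K5-42).
-/

namespace Summit.NavierStokesRegularity.LocalCompactnessRungZeroNoWindowProfile

open Summit.NavierStokesRegularity.FluidComputer.AngularLadder
open Summit.NavierStokesRegularity.RungBlowupCofinalRungZeroNotSingular

/-- A rung-0 window profile has amplitude floor `δ ≤ 0`. [folklore] -/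
theorem windowProfile_zero_floor_nonpos {C₀ cmin cmax δ ε c : ℝ}
    {R : EuclideanSpace ℝ (Fin 3) ≃ₗᵢ[ℝ] EuclideanSpace ℝ (Fin 3)}
    {u : ℝ → EuclideanSpace ℝ (Fin 3) → EuclideanSpace ℝ (Fin 3)}
    {p : ℝ → EuclideanSpace ℝ (Fin 3) → ℝ}
    {d : ℝ → EuclideanSpace ℝ (Fin 3) → EuclideanSpace ℝ (Fin 3)}
    (hW : IsWindowProfile 0 C₀ cmin cmax δ ε c R u p d) : δ ≤ 0 := by
  obtain ⟨x, hx⟩ := hW.2.2.2.1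
  have h0 : u (-1) = 0 := rung_zero_slice_eq_zero hW.1.1 (by norm_num : (-1 : ℝ) ∈ Set.Iio 0)
  simpa [h0] using hx

/-- Hence no rung-0 window profile exists once `0 < δ` (the hypothesis of `LocalCompactness`,
`NoOverheating`, `LimitTransfer`). [folklore] -/
theorem not_isWindowProfile_zero {C₀ cmin cmax δ ε c : ℝ} (hδ : 0 < δ)
    {R : EuclideanSpace ℝ (Fin 3) ≃ₗᵢ[ℝ] EuclideanSpace ℝ (Fin 3)}
    {u : ℝ → EuclideanSpace ℝ (Fin 3) → EuclideanSpace ℝ (Fin 3)}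
    {p : ℝ → EuclideanSpace ℝ (Fin 3) → ℝ}
    {d : ℝ → EuclideanSpace ℝ (Fin 3) → EuclideanSpace ℝ (Fin 3)} :
    ¬ IsWindowProfile 0 C₀ cmin cmax δ ε c R u p d := fun hW =>
  not_lt.2 (windowProfile_zero_floor_nonpos hW) hδ

/-- Window sequences with a positive floor live on rungs `≥ 1`. [folklore] -/
theorem one_le_rung_of_isWindowProfile {L : ℕ} {C₀ cmin cmax δ ε c : ℝ} (hδ : 0 < δ)
    {R : EuclideanSpace ℝ (Fin 3) ≃ₗᵢ[ℝ] EuclideanSpace ℝ (Fin 3)}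
    {u : ℝ → EuclideanSpace ℝ (Fin 3) → EuclideanSpace ℝ (Fin 3)}
    {p : ℝ → EuclideanSpace ℝ (Fin 3) → ℝ}
    {d : ℝ → EuclideanSpace ℝ (Fin 3) → EuclideanSpace ℝ (Fin 3)}
    (hW : IsWindowProfile L C₀ cmin cmax δ ε c R u p d) : 1 ≤ L := by
  rcases Nat.eq_zero_or_pos L with rfl | hL
  · exact absurd hW (not_isWindowProfile_zero hδ)
  · exact hL

end Summit.NavierStokesRegularity.LocalCompactnessRungZeroNoWindowProfile
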